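import Mathlib
import Literature.NumberTheory.LFunctions.MertensConjectureDisproof
import Literature.NumberTheory.LFunctions.InghamSmoothing
import Literature.NumberTheory.LFunctions.MertensOneSided
import Literature.NumberTheory.LFunctions.LevinsonMontgomery
import Literature.NumberTheory.LFunctions.ZetaRealAxis
import HarnessLib

/-!
# Disproof of the Mertens conjecture: the kernel theorem (discharge of (A)), the Jurkat–Peyerimhoff kernel (discharge of (D)) and Brent's zero clause

Topic `Literature/NumberTheory/LFunctions` (trunk T-ANT). Companion ("Proofs" file, D-0014) of
`MertensConjectureDisproof.lean`, which vendors the architecture of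

* A. M. Odlyzko, H. J. J. te Riele, *Disproof of the Mertens conjecture*, J. reine angew. Math.
  **357** (1985), 138–160 [OdlyzkoTeRiele1985]

as three named facts: the kernel theorem `OdlyzkoTeRiele1985_kernelTheorem` (A), the admissibility
of the Jurkat–Peyerimhoff kernel `jurkatPeyerimhoffKernel_admissible` (D) and the numerics
`OdlyzkoTeRiele1985_numerics`. This file **discharges (A) and (D)**:

* `Literature.RH.OdlyzkoTeRiele1985_kernelTheorem_holds : OdlyzkoTeRiele1985_kernelTheorem`;
* `Literature.RH.jurkatPeyerimhoffKernel_admissible_holds : jurkatPeyerimhoffKernel_admissible`;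

so that the disproof of the Mertens conjecture (`odlyzko_te_riele_limsup`, `_liminf`,
`not_mertens_conjecture` of `RHWave0.lean`) now rests on the numerical fact
`OdlyzkoTeRiele1985_numerics` alone (`odlyzko_te_riele_limsup_of_numerics` etc.).

**(A), the kernel theorem** (Ingham 1942; Jurkat–Peyerimhoff 1976; Odlyzko–te Riele §2, Theorem
p. 144). The proof follows Bateman–Diamond, Thm. 11.12, restructured as in
`InghamSmoothing.lean` (the abstract smoothed explicit formula and oscillation theorem
`Literature.NumberTheory.LFunctions.InghamSmoothing.frequently_gt_and_lt_of_laplace`) and `MertensOneSided.lean` (Landau's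
theorem for `M`, the Laplace transform `1/((½+s)ζ(½+s))` of `m(u) = M(e^u)e^{-u/2}` under a
one-sided bound). Here we supply the last two inputs and assemble: (i) the *regular part* — under
the zero hypothesis (zeros with `0 < β < 1`, `|γ| < T` simple and on the line),
`1/((½+s)ζ(½+s)) - Σ_{|γ|<T} (ρζ'(ρ))⁻¹/(s - iγ)` extends continuously to the closed rectangle
`[0,¼] × [-T',T']` for every `T' < T` (`exists_regularPart`: at a simple zero
`ζ(½+z) = (z - iγ₀)·dslope ζ ρ₀ (½+z)` and the difference is a `dslope`, `laplace_sub_polar_eq_dslope`;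
the modification is `R(z) = lim_{w→z} (Z - polar part)(w)`, `exists_continuousOn_modification`);
(ii) the *dilation* `K_c(y) = K(y/c)/c`, `c > 1`, with transform `k(ct)` supported in
`[-T/c, T/c] ⊂ (-T, T)` (`kernelTransform_dilate`), which keeps a possible zero of ordinate
exactly `±T` — not covered by the hypothesis — off the closed rectangle; `c → 1⁺` recovers
`h_K(y₀)` by continuity of `k`. The kernel's integrability comes from evenness and
`K = O((1+y²)⁻¹)` (`integrable_of_even_isBigO`), its mass `∫K = 1` from `k(0) = 1`; the `C²`
hypothesis of the printed theorem is not needed by this proof.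

The witness is the kernel `K_T(y) = (T/π) φ̂(Ty)²` (`jurkatPeyerimhoffSmoothing`), where
`φ̂(u) = (sinc((π-u)/2) + sinc((π+u)/2))/2 = 2π cos(u/2)/(π² - u²)` (`jurkatPeyerimhoffAux`) is the
Fourier transform of the half-period cosine bump `φ = cos(πt) 1_{[-1/2,1/2]}`
(`jurkatPeyerimhoffBump`); so `K_T(y) = 4πT cos²(Ty/2)/(π² - T²y²)²`, the kernel of
Jurkat–Peyerimhoff recalled on p. 150 of the source. The identity `∫ K_T(y) e^{-ity} dy = g(t/T)`
(`kernelTransform_jurkatPeyerimhoffSmoothing`), `g` the Jurkat–Peyerimhoff weight (4.1)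
(`jurkatPeyerimhoffKernel` of the architecture file), is proved by Fourier analysis: `g = 2 φ ⋆ φ`
by an explicit trigonometric integral (`jurkatPeyerimhoffBump_convolution`), hence
`𝓕g = 2 φ̂(2π·)² ≥ 0` by the convolution theorem (the Boas–Kac structure noted on p. 150;
`fourier_jurkatPeyerimhoffKernel`), and Fourier inversion applies to the continuous compactly
supported `g` (`jurkatPeyerimhoffKernel_eq_integral`). The remaining hypotheses — `K_T ∈ C^∞`
(smoothness of `sinc`: `analyticAt_sinc`, `contDiff_sinc`), `K_T ≥ 0`, evenness, and
`K_T(y) = O((1+y²)⁻¹)` (`|φ̂(u)| ≤ 4/|u|` for `|u| ≥ 2π`) — are elementary.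

Also recorded: **Brent 1979** (`Brent1979_zerosSimpleOnLine`, a named fact: the zeros with
`0 < γ < 32 585 736.4` are simple and on the line) and its consequence
`zetaZeros_simple_onLine_of_Brent1979`, the zero clause of the kernel theorem / the numerics for
every `T ≤ 32 585 736.4` (using `riemannZeta_conj`, `deriv_riemannZeta_conj` and the absence of
real zeros in `(0,1)`); and the assembly with (D) discharged
(`odlyzko_te_riele_limsup_of_kernelTheorem` etc.).

## References

* [OdlyzkoTeRiele1985] A. M. Odlyzko, H. J. J. te Riele, Disproof of the Mertens conjecture,
  J. reine angew. Math. 357 (1985), 138–160: §2 (2.6), (2.9), Theorem p. 144, (2.17)–(2.18);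
  §4.1 (4.1), p. 150.
* [BatemanDiamond2004] P. T. Bateman, H. G. Diamond, Analytic Number Theory: An Introductory
  Course, World Scientific 2004: §11.5 Theorem 11.12 and Remarks 11.13; §11.7.
* [Ingham1942] A. E. Ingham, On two conjectures in the theory of numbers, Amer. J. Math. 64
  (1942), 313–319.
* [JurkatPeyerimhoff1976] W. Jurkat, A. Peyerimhoff, A constructive approach to Kronecker
  approximations and its application to the Mertens conjecture, J. reine angew. Math. 286/287
  (1976), 322–340 (the kernel `g` and its non-negative transform).
* [Brent1979] R. P. Brent, On the zeros of the Riemann zeta function in the critical strip,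
  Math. Comp. 33 (1979), 1361–1372, Abstract and §4.
* [Titchmarsh1986] E. C. Titchmarsh, The Theory of the Riemann Zeta-Function, 2nd ed., §2.12.
-/

noncomputable section

open Complex Filter Asymptotics MeasureTheory Set
open scoped Real Topology ComplexConjugate

namespace Literature.NumberTheory.LFunctions

/-! ## The transform (2.9) and the weight `g` of the architecture file -/

/-- The transform `kernelTransform K t = ∫ K(y) e^{-ity} dy` of the architecture file, with the
integrand written as `K(y) · e^{-(ty) i}`. [cite: OdlyzkoTeRiele1985, §2 (2.9)] -/
theorem kernelTransform_eq_integral (K : ℝ → ℝ) (t : ℝ) :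
    kernelTransform K t = ∫ y : ℝ, (K y : ℂ) * cexp (-((t * y : ℝ) : ℂ) * I) := by
  unfold kernelTransform
  congr 1; ext y
  congr 1
  push_cast
  ring_nf

/-- `g` is continuous (the two branches agree at `|t| = 1`). [cite: OdlyzkoTeRiele1985, §4.1 (4.1)] -/
theorem continuous_jurkatPeyerimhoffKernel : Continuous jurkatPeyerimhoffKernel := by
  unfold jurkatPeyerimhoffKernel
  refine Continuous.if_le (by fun_prop) continuous_const (by fun_prop) continuous_const ?_
  intro t ht
  simp [ht]

/-! ## The kernel `K_T` and its transform -/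

/-- The auxiliary transform `φ̂(u) = (sinc((π - u)/2) + sinc((π + u)/2)) / 2`
`= ∫_{-1/2}^{1/2} cos(πt) e^{-iut} dt = 2π cos(u/2) / (π² - u²)` (the last form for `u ≠ ±π`);
`ĝ = 2 φ̂²` is the (non-negative, Boas–Kac) Fourier transform of `g`, cf. p. 150. [folklore] -/
def jurkatPeyerimhoffAux (u : ℝ) : ℝ :=
  (Real.sinc ((π - u) / 2) + Real.sinc ((π + u) / 2)) / 2

/-- The Jurkat–Peyerimhoff kernel with parameter `T`: the function `K = K_T` of the Theorem on
p. 144 whose transform (2.9) is `k(t) = g(t/T)`, i.e. `K_T(y) = (2π)⁻¹ ∫ g(t/T) e^{ity} dt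
= 4πT cos²(Ty/2) / (π² - T²y²)² = (T/π) φ̂(Ty)²`; we take the last expression as the definition
(manifestly `≥ 0`, even and smooth). [cite: OdlyzkoTeRiele1985, §4.1 p. 150] -/
def jurkatPeyerimhoffSmoothing (T : ℝ) (y : ℝ) : ℝ :=
  T / π * jurkatPeyerimhoffAux (T * y) ^ 2

/-! ### Smoothness of `sinc` and admissibility of the kernel -/

/-- `Real.sinc` is real analytic everywhere: at `0` because `sinc = dslope sin 0` and `dslope`
of a function with a power series has a power series (`HasFPowerSeriesAt.has_fpower_series_dslope_fslope`);
elsewhere as the quotient `sin x / x`. [folklore] -/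
theorem analyticAt_sinc (x : ℝ) : AnalyticAt ℝ Real.sinc x := by
  rcases eq_or_ne x 0 with rfl | hx
  · obtain ⟨p, hp⟩ := (Real.analyticAt_sin : AnalyticAt ℝ Real.sin 0)
    rw [Real.sinc_eq_dslope]
    exact ⟨_, hp.has_fpower_series_dslope_fslope⟩
  · have h : (fun y ↦ Real.sin y / y) =ᶠ[𝓝 x] Real.sinc := by
      filter_upwards [isOpen_ne.mem_nhds hx] with y hy
      exact (Real.sinc_of_ne_zero hy).symm
    exact (Real.analyticAt_sin.div analyticAt_id hx).congr h

/-- `Real.sinc` is `C^n` for every `n`. [folklore] -/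
theorem contDiff_sinc {n : WithTop ℕ∞} : ContDiff ℝ n Real.sinc :=
  contDiff_iff_contDiffAt.2 fun x ↦ (analyticAt_sinc x).contDiffAt

/-- `|sinc z| ≤ |z|⁻¹` for `z ≠ 0`. [folklore] -/
theorem abs_sinc_le_inv_abs {z : ℝ} (hz : z ≠ 0) : |Real.sinc z| ≤ |z|⁻¹ := by
  rw [Real.sinc_of_ne_zero hz, abs_div, div_eq_mul_inv]
  exact mul_le_of_le_one_left (inv_nonneg.2 (abs_nonneg z)) (Real.abs_sin_le_one z)

/-- `φ̂` is `C^n` for every `n`. [folklore] -/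
theorem contDiff_jurkatPeyerimhoffAux {n : WithTop ℕ∞} : ContDiff ℝ n jurkatPeyerimhoffAux := by
  unfold jurkatPeyerimhoffAux
  refine ContDiff.div_const (ContDiff.add ?_ ?_) _
  · exact contDiff_sinc.comp (by fun_prop)
  · exact contDiff_sinc.comp (by fun_prop)

/-- Decay of `φ̂`: `|φ̂(u)| ≤ 4 / |u|` for `|u| ≥ 2π` (from `|sinc z| ≤ 1/|z|` and
`|π ± u| ≥ |u|/2`). [folklore] -/
theorem abs_jurkatPeyerimhoffAux_le {u : ℝ} (hu : 2 * π ≤ |u|) :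
    |jurkatPeyerimhoffAux u| ≤ 4 / |u| := by
  have hπ := Real.pi_pos
  have hu0 : 0 < |u| := by linarith
  have h1 : |u| / 2 ≤ |π - u| := by
    have := abs_sub_abs_le_abs_sub u π
    rw [abs_sub_comm, abs_of_pos hπ] at this
    linarith
  have h2 : |u| / 2 ≤ |π + u| := by
    have := abs_add_le (π + u) (-π)
    rw [abs_neg, abs_of_pos hπ, add_neg_cancel_comm] at this
    linarith
  have key : ∀ v : ℝ, |u| / 2 ≤ |v| → |Real.sinc (v / 2)| ≤ 4 / |u| := by
    intro v hv
    have hv0 : v / 2 ≠ 0 := by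
      intro h
      have : v = 0 := by linarith
      rw [this, abs_zero] at hv
      linarith
    calc |Real.sinc (v / 2)| ≤ |v / 2|⁻¹ := abs_sinc_le_inv_abs hv0
      _ = 2 / |v| := by rw [abs_div, abs_two, inv_div]
      _ ≤ 2 / (|u| / 2) := by gcongr
      _ = 4 / |u| := by field_simp; ring
  have k1 := key _ h1
  have k2 := key _ h2
  have hadd := abs_add_le (Real.sinc ((π - u) / 2)) (Real.sinc ((π + u) / 2))
  unfold jurkatPeyerimhoffAux
  rw [abs_div, abs_two]
  linarith

/-- `φ̂` is even. [folklore] -/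
theorem jurkatPeyerimhoffAux_neg (u : ℝ) : jurkatPeyerimhoffAux (-u) = jurkatPeyerimhoffAux u := by
  unfold jurkatPeyerimhoffAux
  rw [add_comm, sub_neg_eq_add, ← sub_eq_add_neg]

/-- `K_T ≥ 0` (for `T ≥ 0`). [folklore] -/
theorem jurkatPeyerimhoffSmoothing_nonneg {T : ℝ} (hT : 0 ≤ T) (y : ℝ) :
    0 ≤ jurkatPeyerimhoffSmoothing T y := by
  unfold jurkatPeyerimhoffSmoothing
  positivity

/-- `K_T` is even. [folklore] -/
theorem jurkatPeyerimhoffSmoothing_neg (T y : ℝ) :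
    jurkatPeyerimhoffSmoothing T (-y) = jurkatPeyerimhoffSmoothing T y := by
  unfold jurkatPeyerimhoffSmoothing
  rw [mul_neg, jurkatPeyerimhoffAux_neg]

/-- `K_T` is `C^n` for every `n` (in particular `C²`, as the Theorem on p. 144 requires). [folklore] -/
theorem contDiff_jurkatPeyerimhoffSmoothing (T : ℝ) {n : WithTop ℕ∞} :
    ContDiff ℝ n (jurkatPeyerimhoffSmoothing T) := by
  unfold jurkatPeyerimhoffSmoothing
  exact contDiff_const.mul
    ((contDiff_jurkatPeyerimhoffAux.comp (contDiff_const.mul contDiff_id)).pow 2)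

/-- `K_T(y) = O((1 + y²)⁻¹)` as `y → ∞` (indeed `K_T(y) ≤ 16 / (π T y²)` for `Ty ≥ 2π`).
[folklore] -/
theorem jurkatPeyerimhoffSmoothing_isBigO {T : ℝ} (hT : 0 < T) :
    jurkatPeyerimhoffSmoothing T =O[atTop] fun y : ℝ ↦ (1 + y ^ 2)⁻¹ := by
  have hπ := Real.pi_pos
  refine IsBigO.of_bound (32 / (π * T)) ?_
  filter_upwards [eventually_ge_atTop (1 : ℝ), eventually_ge_atTop (2 * π / T)] with y hy1 hy2
  have hy : 0 < y := by linarith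
  have hTy : 0 < T * y := by positivity
  have hu : 2 * π ≤ |T * y| := by
    rw [abs_of_pos hTy]
    have := (div_le_iff₀ hT).1 hy2
    linarith [mul_comm y T]
  have hφ := abs_jurkatPeyerimhoffAux_le hu
  rw [abs_of_pos hTy] at hφ
  have hK0 : 0 ≤ jurkatPeyerimhoffSmoothing T y := jurkatPeyerimhoffSmoothing_nonneg hT.le y
  have hK : jurkatPeyerimhoffSmoothing T y ≤ 16 / (π * T * y ^ 2) := by
    unfold jurkatPeyerimhoffSmoothing
    have hsq : jurkatPeyerimhoffAux (T * y) ^ 2 ≤ (4 / (T * y)) ^ 2 := by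
      rw [← sq_abs]
      gcongr
    calc T / π * jurkatPeyerimhoffAux (T * y) ^ 2 ≤ T / π * (4 / (T * y)) ^ 2 := by gcongr
      _ = 16 / (π * T * y ^ 2) := by field_simp; ring
  rw [Real.norm_of_nonneg hK0, Real.norm_of_nonneg (by positivity)]
  have hfrac : 16 / (π * T * y ^ 2) ≤ 32 / (π * T) * (1 + y ^ 2)⁻¹ := by
    rw [← div_eq_mul_inv, div_div, div_le_div_iff₀ (by positivity) (by positivity)]
    have hπT : 0 < π * T := mul_pos hπ hT
    have hy2 : 1 ≤ y ^ 2 := by nlinarith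
    nlinarith [mul_le_mul_of_nonneg_left hy2 hπT.le]
  exact hK.trans hfrac

/-! ## (D) The transform of the Jurkat–Peyerimhoff kernel: `∫ K_T(y) e^{-ity} dy = g(t/T)`

Fourier analysis of the weight (4.1): with the half-period cosine bump
`φ(t) = cos(πt) 1_{[-1/2,1/2]}(t)` one has `𝓕φ(w) = φ̂(2πw)` (`φ̂ = jurkatPeyerimhoffAux`),
`g = 2 φ ⋆ φ` (an elementary trigonometric integral), hence `𝓕g(w) = 2 φ̂(2πw)² ≥ 0` by the
convolution theorem (`Real.fourier_mul_convolution_eq`; this is the Boas–Kac property of `g`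
recalled on p. 150), and Fourier inversion for the continuous, compactly supported `g` with
integrable transform (`Continuous.fourierInv_fourier_eq`) gives `g(s) = ∫ 2 φ̂(2πw)² e^{2πiws} dw`,
which after the substitution `Ty = 2πw` reads `∫ K_T(y) e^{-ity} dy = g(t/T)`. -/

open scoped FourierTransform Convolution

/-- The half-period cosine bump `φ(t) = cos(πt)` for `|t| ≤ 1/2`, `0` otherwise
(complex-valued; `g = 2 φ ⋆ φ`, cf. the Boas–Kac discussion on p. 150). [folklore] -/
def jurkatPeyerimhoffBump : ℝ → ℂ :=
  (Set.Icc (-(1 / 2 : ℝ)) (1 / 2)).indicator fun t ↦ (Real.cos (π * t) : ℂ)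

/-- `∫_{-1/2}^{1/2} e^{ibt} dt = sinc(b/2)`. [folklore] -/
theorem integral_cexp_mul_I_eq_sinc_half (b : ℝ) :
    ∫ t in (-(1 / 2 : ℝ))..(1 / 2), cexp (((b * t : ℝ) : ℂ) * I) = Real.sinc (b / 2) := by
  rcases eq_or_ne b 0 with rfl | hb
  · norm_num
  · have h := intervalIntegral.integral_comp_mul_left (a := -(1 / 2 : ℝ)) (b := 1 / 2)
      (fun t : ℝ ↦ cexp ((t : ℂ) * I)) hb
    rw [h, show b * (-(1 / 2 : ℝ)) = -(b / 2) by ring, show b * (1 / 2 : ℝ) = b / 2 by ring,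
      integral_exp_mul_I_eq_sinc, Complex.real_smul]
    have hb' : (b : ℂ) ≠ 0 := by exact_mod_cast hb
    push_cast
    field_simp

/-- `𝓕φ(w) = φ̂(2πw)` with `φ̂ = jurkatPeyerimhoffAux`:
`∫_{-1/2}^{1/2} cos(πt) e^{-2πitw} dt = (sinc((π-u)/2) + sinc((π+u)/2))/2`, `u = 2πw`. [folklore] -/
theorem fourier_jurkatPeyerimhoffBump (w : ℝ) :
    𝓕 jurkatPeyerimhoffBump w = (jurkatPeyerimhoffAux (2 * π * w) : ℂ) := by
  rw [Real.fourier_real_eq_integral_exp_smul]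
  unfold jurkatPeyerimhoffBump
  simp_rw [smul_eq_mul]
  have hexp : ∀ v : ℝ, cexp (((-2 * π * v * w : ℝ) : ℂ) * I) * (Real.cos (π * v) : ℂ) =
      (1 / 2 : ℂ) * (cexp ((((π - 2 * π * w) * v : ℝ) : ℂ) * I) +
        cexp ((((-(π + 2 * π * w)) * v : ℝ) : ℂ) * I)) := by
    intro v
    have hc : (Real.cos (π * v) : ℂ) = (cexp (((π * v : ℝ) : ℂ) * I) +
        cexp (-((π * v : ℝ) : ℂ) * I)) / 2 := by
      rw [Complex.ofReal_cos, ← Complex.two_cos]; ring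
    rw [hc, mul_div_assoc', mul_add, ← Complex.exp_add, ← Complex.exp_add]
    have e1 : ((-2 * π * v * w : ℝ) : ℂ) * I + ((π * v : ℝ) : ℂ) * I =
        (((π - 2 * π * w) * v : ℝ) : ℂ) * I := by push_cast; ring
    have e2 : ((-2 * π * v * w : ℝ) : ℂ) * I + -((π * v : ℝ) : ℂ) * I =
        (((-(π + 2 * π * w)) * v : ℝ) : ℂ) * I := by push_cast; ring
    rw [e1, e2]; ring
  have hind : ∀ v : ℝ, cexp (((-2 * π * v * w : ℝ) : ℂ) * I) *
      (Set.Icc (-(1 / 2 : ℝ)) (1 / 2)).indicator (fun t ↦ (Real.cos (π * t) : ℂ)) v =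
      (Set.Icc (-(1 / 2 : ℝ)) (1 / 2)).indicator (fun v ↦ (1 / 2 : ℂ) *
        (cexp ((((π - 2 * π * w) * v : ℝ) : ℂ) * I) +
          cexp ((((-(π + 2 * π * w)) * v : ℝ) : ℂ) * I))) v := by
    intro v
    by_cases hv : v ∈ Set.Icc (-(1 / 2 : ℝ)) (1 / 2)
    · rw [Set.indicator_of_mem hv, Set.indicator_of_mem hv, hexp]
    · rw [Set.indicator_of_notMem hv, Set.indicator_of_notMem hv, mul_zero]
  simp_rw [hind]
  rw [integral_indicator measurableSet_Icc, integral_Icc_eq_integral_Ioc,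
    ← intervalIntegral.integral_of_le (by norm_num), intervalIntegral.integral_const_mul,
    intervalIntegral.integral_add, integral_cexp_mul_I_eq_sinc_half,
    integral_cexp_mul_I_eq_sinc_half]
  · unfold jurkatPeyerimhoffAux
    rw [show -(π + 2 * π * w) / 2 = -((π + 2 * π * w) / 2) by ring, Real.sinc_neg]
    push_cast; ring
  · exact (by fun_prop : Continuous fun t : ℝ ↦
      cexp ((((π - 2 * π * w) * t : ℝ) : ℂ) * I)).intervalIntegrable _ _
  · exact (by fun_prop : Continuous fun t : ℝ ↦
      cexp ((((-(π + 2 * π * w)) * t : ℝ) : ℂ) * I)).intervalIntegrable _ _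

/-- The integrand of `φ ⋆ φ` at `x`: `φ(t) φ(x - t) = cos(πt) cos(π(x-t))` on
`[-1/2, 1/2] ∩ [x - 1/2, x + 1/2]` and `0` elsewhere. [folklore] -/
theorem jurkatPeyerimhoffBump_mul_shift (x t : ℝ) :
    jurkatPeyerimhoffBump t * jurkatPeyerimhoffBump (x - t) =
      (Set.Icc (max (-(1 / 2 : ℝ)) (x - 1 / 2)) (min (1 / 2) (x + 1 / 2))).indicator
        (fun t ↦ (Real.cos (π * t) : ℂ) * (Real.cos (π * (x - t)) : ℂ)) t := by
  by_cases h1 : t ∈ Set.Icc (-(1 / 2 : ℝ)) (1 / 2)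
  · by_cases h2 : x - t ∈ Set.Icc (-(1 / 2 : ℝ)) (1 / 2)
    · have h3 : t ∈ Set.Icc (max (-(1 / 2 : ℝ)) (x - 1 / 2)) (min (1 / 2) (x + 1 / 2)) := by
        simp only [Set.mem_Icc, max_le_iff, le_min_iff] at h1 h2 ⊢
        exact ⟨⟨h1.1, by linarith⟩, h1.2, by linarith⟩
      simp only [jurkatPeyerimhoffBump, Set.indicator_of_mem h1, Set.indicator_of_mem h2,
        Set.indicator_of_mem h3]
    · have h3 : t ∉ Set.Icc (max (-(1 / 2 : ℝ)) (x - 1 / 2)) (min (1 / 2) (x + 1 / 2)) := by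
        simp only [Set.mem_Icc, max_le_iff, le_min_iff] at h1 h2 ⊢
        exact fun h ↦ h2 ⟨by linarith [h.2.2], by linarith [h.1.2]⟩
      simp only [jurkatPeyerimhoffBump, Set.indicator_of_mem h1, Set.indicator_of_notMem h2,
        Set.indicator_of_notMem h3, mul_zero]
  · have h3 : t ∉ Set.Icc (max (-(1 / 2 : ℝ)) (x - 1 / 2)) (min (1 / 2) (x + 1 / 2)) := by
      simp only [Set.mem_Icc, max_le_iff, le_min_iff] at h1 ⊢
      exact fun h ↦ h1 ⟨h.1.1, h.2.1⟩
    simp only [jurkatPeyerimhoffBump, Set.indicator_of_notMem h1, Set.indicator_of_notMem h3,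
      zero_mul]

/-- An antiderivative: `d/dt [t cos(πx)/2 + sin(π(2t-x))/(4π)] = cos(πt) cos(π(x-t))`
(product-to-sum). [folklore] -/
theorem hasDerivAt_cos_mul_cos_shift (x t : ℝ) :
    HasDerivAt (fun t : ℝ ↦ t * (Real.cos (π * x) / 2) + Real.sin (π * (2 * t - x)) / (4 * π))
      (Real.cos (π * t) * Real.cos (π * (x - t))) t := by
  have h1 : HasDerivAt (fun t : ℝ ↦ t * (Real.cos (π * x) / 2)) (Real.cos (π * x) / 2) t := by
    simpa using (hasDerivAt_id t).mul_const (Real.cos (π * x) / 2)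
  have h2 : HasDerivAt (fun t : ℝ ↦ Real.sin (π * (2 * t - x)) / (4 * π))
      (Real.cos (π * (2 * t - x)) * (π * 2) / (4 * π)) t := by
    have hlin : HasDerivAt (fun t : ℝ ↦ π * (2 * t - x)) (π * 2) t := by
      have := ((hasDerivAt_id t).const_mul 2).sub_const x
      simpa using this.const_mul π
    exact ((Real.hasDerivAt_sin _).comp t hlin).div_const _
  have h : HasDerivAt (fun t : ℝ ↦ t * (Real.cos (π * x) / 2) + Real.sin (π * (2 * t - x)) / (4 * π))
      (Real.cos (π * x) / 2 + Real.cos (π * (2 * t - x)) * (π * 2) / (4 * π)) t := h1.add h2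
  refine h.congr_deriv ?_
  have hπ : π ≠ 0 := Real.pi_ne_zero
  rw [show π * (x - t) = π * x - π * t by ring, show π * (2 * t - x) = 2 * (π * t) - π * x by ring,
    Real.cos_sub, Real.cos_sub, Real.cos_two_mul, Real.sin_two_mul]
  field_simp
  ring

/-- `∫_a^b cos(πt) cos(π(x-t)) dt` in closed form. [folklore] -/
theorem integral_cos_mul_cos_shift (x a b : ℝ) :
    ∫ t in a..b, Real.cos (π * t) * Real.cos (π * (x - t)) =
      (b * (Real.cos (π * x) / 2) + Real.sin (π * (2 * b - x)) / (4 * π)) -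
        (a * (Real.cos (π * x) / 2) + Real.sin (π * (2 * a - x)) / (4 * π)) :=
  intervalIntegral.integral_eq_sub_of_hasDerivAt (fun t _ ↦ hasDerivAt_cos_mul_cos_shift x t)
    ((by fun_prop : Continuous fun t : ℝ ↦
      Real.cos (π * t) * Real.cos (π * (x - t))).intervalIntegrable _ _)

/-- **`g = 2 φ ⋆ φ`**: the Jurkat–Peyerimhoff weight is twice the autocorrelation of the
half-period cosine bump, `(φ ⋆ φ)(x) = g(x)/2` for every real `x`. [folklore] -/
theorem jurkatPeyerimhoffBump_convolution (x : ℝ) :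
    (jurkatPeyerimhoffBump ⋆[ContinuousLinearMap.mul ℂ ℂ] jurkatPeyerimhoffBump) x =
      ((jurkatPeyerimhoffKernel x / 2 : ℝ) : ℂ) := by
  rw [convolution_def]
  simp only [ContinuousLinearMap.mul_apply']
  simp_rw [jurkatPeyerimhoffBump_mul_shift x]
  rw [integral_indicator measurableSet_Icc]
  rcases le_or_gt |x| 1 with hx | hx
  swap
  · -- the supports are disjoint
    have hempty : Set.Icc (max (-(1 / 2 : ℝ)) (x - 1 / 2)) (min (1 / 2) (x + 1 / 2)) = ∅ := by
      refine Set.Icc_eq_empty ?_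
      rcases lt_abs.1 hx with h | h
      · have : min (1 / 2 : ℝ) (x + 1 / 2) < max (-(1 / 2 : ℝ)) (x - 1 / 2) :=
          lt_of_le_of_lt (min_le_left _ _) (lt_of_lt_of_le (by linarith) (le_max_right _ _))
        exact not_le.2 this
      · have : min (1 / 2 : ℝ) (x + 1 / 2) < max (-(1 / 2 : ℝ)) (x - 1 / 2) :=
          lt_of_le_of_lt (min_le_right _ _) (lt_of_lt_of_le (by linarith) (le_max_left _ _))
        exact not_le.2 this
    rw [hempty, Measure.restrict_empty, integral_zero_measure,
      jurkatPeyerimhoffKernel_of_one_le_abs hx.le]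
    simp
  · have hlohi : max (-(1 / 2 : ℝ)) (x - 1 / 2) ≤ min (1 / 2) (x + 1 / 2) := by
      rw [abs_le] at hx
      simp only [max_le_iff, le_min_iff]
      exact ⟨⟨by norm_num, by linarith⟩, by linarith, by linarith⟩
    rw [integral_Icc_eq_integral_Ioc, ← intervalIntegral.integral_of_le hlohi]
    simp_rw [← Complex.ofReal_mul]
    rw [intervalIntegral.integral_ofReal, integral_cos_mul_cos_shift]
    congr 1
    unfold jurkatPeyerimhoffKernel
    rw [if_pos hx]
    rcases le_or_gt 0 x with hx0 | hx0
    · rw [max_eq_right (by linarith), min_eq_left (by linarith), abs_of_nonneg hx0,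
        show π * (2 * (1 / 2) - x) = π - π * x by ring,
        show π * (2 * (x - 1 / 2) - x) = π * x - π by ring, Real.sin_pi_sub, Real.sin_sub_pi]
      field_simp
      ring
    · rw [max_eq_left (by linarith), min_eq_right (by linarith), abs_of_neg hx0,
        show π * (2 * (x + 1 / 2) - x) = π * x + π by ring,
        show π * (2 * (-(1 / 2)) - x) = -(π * x + π) by ring, Real.sin_neg, Real.sin_add_pi,
        mul_neg, Real.sin_neg]
      field_simp
      ring

/-- `φ` is integrable (bounded, measurable, compact support). [folklore] -/
theorem integrable_jurkatPeyerimhoffBump : Integrable jurkatPeyerimhoffBump := by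
  unfold jurkatPeyerimhoffBump
  exact (integrable_indicator_iff measurableSet_Icc).2
    ((by fun_prop : Continuous fun t : ℝ ↦ (Real.cos (π * t) : ℂ)).integrableOn_Icc)

/-- `g = 2 (φ ⋆ φ)` as complex-valued functions. [folklore] -/
theorem jurkatPeyerimhoffKernel_eq_convolution :
    (fun x ↦ ((jurkatPeyerimhoffKernel x : ℝ) : ℂ)) =
      (2 : ℂ) • (jurkatPeyerimhoffBump ⋆[ContinuousLinearMap.mul ℂ ℂ] jurkatPeyerimhoffBump) := by
  ext x
  rw [Pi.smul_apply, jurkatPeyerimhoffBump_convolution, smul_eq_mul]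
  push_cast
  ring

/-- **`𝓕g = 2 φ̂(2π·)²`**: the Fourier transform (Mathlib normalisation
`𝓕g(w) = ∫ g(t) e^{-2πitw} dt`) of the Jurkat–Peyerimhoff weight is `2 φ̂(2πw)²`; in particular
it is non-negative (Boas–Kac, p. 150). [folklore] -/
theorem fourier_jurkatPeyerimhoffKernel (w : ℝ) :
    𝓕 (fun x ↦ ((jurkatPeyerimhoffKernel x : ℝ) : ℂ)) w =
      2 * (jurkatPeyerimhoffAux (2 * π * w) : ℂ) ^ 2 := by
  rw [jurkatPeyerimhoffKernel_eq_convolution]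
  change VectorFourier.fourierIntegral 𝐞 volume (innerₗ ℝ) ((2 : ℂ) • _) w = _
  rw [VectorFourier.fourierIntegral_const_smul, Pi.smul_apply, smul_eq_mul]
  change 2 * 𝓕 (jurkatPeyerimhoffBump ⋆[ContinuousLinearMap.mul ℂ ℂ] jurkatPeyerimhoffBump) w = _
  rw [Real.fourier_mul_convolution_eq integrable_jurkatPeyerimhoffBump
    integrable_jurkatPeyerimhoffBump, fourier_jurkatPeyerimhoffBump, sq]

/-- `|φ̂(u)| ≤ 1`. [folklore] -/
theorem abs_jurkatPeyerimhoffAux_le_one (u : ℝ) : |jurkatPeyerimhoffAux u| ≤ 1 := by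
  unfold jurkatPeyerimhoffAux
  rw [abs_div, abs_two]
  have h1 := Real.abs_sinc_le_one ((π - u) / 2)
  have h2 := Real.abs_sinc_le_one ((π + u) / 2)
  have h3 := abs_add_le (Real.sinc ((π - u) / 2)) (Real.sinc ((π + u) / 2))
  linarith

/-- `φ̂(u)² ≤ (32 + 4π²) (1 + u²)⁻¹`. [folklore] -/
theorem jurkatPeyerimhoffAux_sq_le (u : ℝ) :
    jurkatPeyerimhoffAux u ^ 2 ≤ (32 + 4 * π ^ 2) * (1 + u ^ 2)⁻¹ := by
  have hπ := Real.pi_pos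
  have h3 : 3 < π := Real.pi_gt_three
  rw [← div_eq_mul_inv, le_div_iff₀ (by positivity)]
  rcases le_or_gt (2 * π) |u| with hu | hu
  · have hb := abs_jurkatPeyerimhoffAux_le hu
    have hu0 : 0 < |u| := by linarith
    have hsq : jurkatPeyerimhoffAux u ^ 2 ≤ (4 / |u|) ^ 2 := by
      rw [← sq_abs]; gcongr
    have hu2 : 0 < u ^ 2 := by rw [← sq_abs]; exact pow_pos hu0 2
    have hsq' : (4 / |u|) ^ 2 * (1 + u ^ 2) ≤ 32 := by
      rw [div_pow, sq_abs, div_mul_eq_mul_div, div_le_iff₀ hu2]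
      have : 1 ≤ u ^ 2 := by rw [← sq_abs]; nlinarith
      nlinarith
    calc jurkatPeyerimhoffAux u ^ 2 * (1 + u ^ 2) ≤ (4 / |u|) ^ 2 * (1 + u ^ 2) := by gcongr
      _ ≤ 32 := hsq'
      _ ≤ 32 + 4 * π ^ 2 := by nlinarith [sq_nonneg π]
  · have hb := abs_jurkatPeyerimhoffAux_le_one u
    have hsq : jurkatPeyerimhoffAux u ^ 2 ≤ 1 := by
      rw [← sq_abs]; nlinarith [abs_nonneg (jurkatPeyerimhoffAux u)]
    have hu2 : u ^ 2 < (2 * π) ^ 2 := by rw [← sq_abs]; gcongr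
    nlinarith

/-- The transform `2 φ̂(2πw)²` is integrable (it is continuous and `O((1+w²)⁻¹)`). [folklore] -/
theorem integrable_fourier_jurkatPeyerimhoffKernel :
    Integrable (𝓕 (fun x ↦ ((jurkatPeyerimhoffKernel x : ℝ) : ℂ))) := by
  have heq : 𝓕 (fun x ↦ ((jurkatPeyerimhoffKernel x : ℝ) : ℂ)) =
      fun w ↦ 2 * (jurkatPeyerimhoffAux (2 * π * w) : ℂ) ^ 2 := funext fourier_jurkatPeyerimhoffKernel
  rw [heq]
  have hcont : Continuous fun w ↦ 2 * (jurkatPeyerimhoffAux (2 * π * w) : ℂ) ^ 2 := by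
    have := contDiff_jurkatPeyerimhoffAux (n := 0)
    rw [contDiff_zero] at this
    fun_prop
  refine Integrable.mono' ((integrable_inv_one_add_sq).const_mul (2 * (32 + 4 * π ^ 2)))
    hcont.aestronglyMeasurable (Eventually.of_forall fun w ↦ ?_)
  rw [norm_mul, Complex.norm_ofNat, norm_pow, Complex.norm_real, Real.norm_eq_abs, sq_abs]
  have hπ := Real.pi_pos
  have h3 : 3 < π := Real.pi_gt_three
  have hw : 1 + w ^ 2 ≤ 1 + (2 * π * w) ^ 2 := by
    have h1 : (2 * π * w) ^ 2 = 4 * π ^ 2 * w ^ 2 := by ring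
    have h2 : 0 ≤ (4 * π ^ 2 - 1) * w ^ 2 := mul_nonneg (by nlinarith) (sq_nonneg w)
    nlinarith
  have hb : jurkatPeyerimhoffAux (2 * π * w) ^ 2 ≤ (32 + 4 * π ^ 2) * (1 + w ^ 2)⁻¹ :=
    (jurkatPeyerimhoffAux_sq_le _).trans
      (mul_le_mul_of_nonneg_left (inv_anti₀ (by positivity) hw) (by positivity))
  linarith

/-- `g` (as a complex-valued function) has compact support (in `[-1, 1]`). [folklore] -/
theorem hasCompactSupport_jurkatPeyerimhoffKernel :
    HasCompactSupport fun x ↦ ((jurkatPeyerimhoffKernel x : ℝ) : ℂ) := by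
  refine HasCompactSupport.of_support_subset_isCompact (isCompact_Icc (a := -1) (b := 1)) ?_
  intro x hx
  rw [Function.mem_support] at hx
  by_contra h
  apply hx
  rw [jurkatPeyerimhoffKernel_of_one_le_abs, Complex.ofReal_zero]
  simp only [Set.mem_Icc, not_and_or, not_le] at h
  rcases h with h | h
  · rw [abs_of_neg (by linarith)]; linarith
  · rw [abs_of_pos (by linarith)]; linarith

/-- **Fourier inversion for `g`**: `g(s) = ∫ 2 φ̂(2πw)² e^{2πiws} dw` for every real `s`
(`g` is continuous with compact support and its transform is integrable;
`Continuous.fourierInv_fourier_eq`). [folklore] -/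
theorem jurkatPeyerimhoffKernel_eq_integral (s : ℝ) :
    ((jurkatPeyerimhoffKernel s : ℝ) : ℂ) =
      ∫ w : ℝ, cexp (((2 * π * w * s : ℝ) : ℂ) * I) * (2 * (jurkatPeyerimhoffAux (2 * π * w) : ℂ) ^ 2) := by
  have hcont : Continuous fun x ↦ ((jurkatPeyerimhoffKernel x : ℝ) : ℂ) :=
    Complex.continuous_ofReal.comp continuous_jurkatPeyerimhoffKernel
  have hinv := hcont.fourierInv_fourier_eq
    (hcont.integrable_of_hasCompactSupport hasCompactSupport_jurkatPeyerimhoffKernel)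
    integrable_fourier_jurkatPeyerimhoffKernel
  have hs := congr_fun hinv s
  rw [← hs, Real.fourierInv_eq_fourier_neg, Real.fourier_real_eq_integral_exp_smul]
  congr 1
  ext w
  rw [fourier_jurkatPeyerimhoffKernel, smul_eq_mul]
  congr 2
  push_cast
  ring

/-- **(D) The Jurkat–Peyerimhoff kernel realises the weight (4.1)**: for `T > 0` and every real
`t`, `∫_{-∞}^{∞} K_T(y) e^{-ity} dy = g(t/T)`, where `K_T(y) = (T/π) φ̂(Ty)²`
(`= 4πT cos²(Ty/2)/(π² - T²y²)²`) and `g` is the Jurkat–Peyerimhoff weight; from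
`jurkatPeyerimhoffKernel_eq_integral` by the substitution `Ty = 2πw` and the evenness of `g`. This
is the analytic input that makes `k(t) = g(t/T)` an admissible choice in the Theorem on p. 144, as
used in §4.1. [cite: OdlyzkoTeRiele1985, §4.1 (4.1) and p. 150] -/
theorem kernelTransform_jurkatPeyerimhoffSmoothing {T : ℝ} (hT : 0 < T) (t : ℝ) :
    kernelTransform (jurkatPeyerimhoffSmoothing T) t = ((jurkatPeyerimhoffKernel (t / T) : ℝ) : ℂ) := by
  have hπ := Real.pi_pos
  have hT0 : T ≠ 0 := hT.ne'
  have hc : T / (2 * π) ≠ 0 := by positivity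
  set h : ℝ → ℂ := fun w ↦ cexp (((2 * π * w * (-(t / T)) : ℝ) : ℂ) * I) *
    (2 * (jurkatPeyerimhoffAux (2 * π * w) : ℂ) ^ 2) with hh
  have key := jurkatPeyerimhoffKernel_eq_integral (-(t / T))
  rw [jurkatPeyerimhoffKernel_neg] at key
  have hsub := Measure.integral_comp_mul_left h (T / (2 * π))
  rw [kernelTransform_eq_integral]
  unfold jurkatPeyerimhoffSmoothing
  calc ∫ y : ℝ, ((T / π * jurkatPeyerimhoffAux (T * y) ^ 2 : ℝ) : ℂ) * cexp (-((t * y : ℝ) : ℂ) * I)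
      = ∫ y : ℝ, ((T / (2 * π) : ℝ) : ℂ) * h (T / (2 * π) * y) := by
        congr 1
        ext y
        simp only [hh]
        have e1 : 2 * π * (T / (2 * π) * y) = T * y := by field_simp
        have e2 : ((T * y * (-(t / T)) : ℝ) : ℂ) * I = -((t * y : ℝ) : ℂ) * I := by
          congr 1
          rw [← Complex.ofReal_neg]
          congr 1
          field_simp
        rw [e1, e2]
        push_cast
        ring
    _ = ((T / (2 * π) : ℝ) : ℂ) * ∫ y : ℝ, h (T / (2 * π) * y) := integral_const_mul _ _
    _ = ((T / (2 * π) : ℝ) : ℂ) * (|(T / (2 * π))⁻¹| • ∫ w : ℝ, h w) := by rw [hsub]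
    _ = ∫ w : ℝ, h w := by
        rw [abs_of_pos (inv_pos.2 (by positivity)), Complex.real_smul, ← mul_assoc,
          ← Complex.ofReal_mul, mul_inv_cancel₀ hc, Complex.ofReal_one, one_mul]
    _ = ((jurkatPeyerimhoffKernel (t / T) : ℝ) : ℂ) := key.symm

/-- `k(t) = g(t/T)` vanishes for `|t| ≥ T`. [cite: OdlyzkoTeRiele1985, §4.1 p. 150] -/
theorem kernelTransform_jurkatPeyerimhoffSmoothing_eq_zero {T : ℝ} (hT : 0 < T) {t : ℝ}
    (ht : T ≤ |t|) : kernelTransform (jurkatPeyerimhoffSmoothing T) t = 0 := by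
  rw [kernelTransform_jurkatPeyerimhoffSmoothing hT t, jurkatPeyerimhoffKernel_of_one_le_abs,
    ofReal_zero]
  rwa [abs_div, abs_of_pos hT, le_div_iff₀ hT, one_mul]

/-- `k(0) = g(0) = 1`. [cite: OdlyzkoTeRiele1985, §4.1 p. 150] -/
theorem kernelTransform_jurkatPeyerimhoffSmoothing_zero {T : ℝ} (hT : 0 < T) :
    kernelTransform (jurkatPeyerimhoffSmoothing T) 0 = 1 := by
  rw [kernelTransform_jurkatPeyerimhoffSmoothing hT 0, zero_div, jurkatPeyerimhoffKernel_zero,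
    ofReal_one]

/-- **Discharge of the named fact `jurkatPeyerimhoffKernel_admissible`** (Odlyzko–te Riele §4.1,
p. 150; Jurkat–Peyerimhoff 1976): for every `T > 0` the kernel `K_T(y) = (T/π) φ̂(Ty)²`
(`= 4πT cos²(Ty/2)/(π² - T²y²)²`) is `C²` (indeed `C^∞`), non-negative, even, `O((1+y²)⁻¹)`, and
its transform (2.9) is `g(t/T)`. [cite: OdlyzkoTeRiele1985, §4.1 (4.1) p. 150; JurkatPeyerimhoff1976] -/
theorem jurkatPeyerimhoffKernel_admissible_holds : jurkatPeyerimhoffKernel_admissible :=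
  fun T hT ↦ ⟨jurkatPeyerimhoffSmoothing T, contDiff_jurkatPeyerimhoffSmoothing T,
    jurkatPeyerimhoffSmoothing_nonneg hT.le, jurkatPeyerimhoffSmoothing_neg T,
    jurkatPeyerimhoffSmoothing_isBigO hT, kernelTransform_jurkatPeyerimhoffSmoothing hT⟩

/-! ## The assembly with (D) discharged -/

/-- With the admissibility of the Jurkat–Peyerimhoff kernel proved, the positive side of the
disproof needs only the kernel theorem (A) and the numerics of Table 3.
[cite: OdlyzkoTeRiele1985, p. 155 and p. 139] -/
theorem odlyzko_te_riele_limsup_of_kernelTheorem (h₁ : OdlyzkoTeRiele1985_kernelTheorem)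
    (h₃ : OdlyzkoTeRiele1985_numerics) : odlyzko_te_riele_limsup :=
  odlyzko_te_riele_limsup_of_facts h₁ jurkatPeyerimhoffKernel_admissible_holds h₃

/-- Likewise for the negative side. [cite: OdlyzkoTeRiele1985, p. 155 and p. 139] -/
theorem odlyzko_te_riele_liminf_of_kernelTheorem (h₁ : OdlyzkoTeRiele1985_kernelTheorem)
    (h₃ : OdlyzkoTeRiele1985_numerics) : odlyzko_te_riele_liminf :=
  odlyzko_te_riele_liminf_of_facts h₁ jurkatPeyerimhoffKernel_admissible_holds h₃

/-- And for the refutation of the Mertens conjecture. [cite: OdlyzkoTeRiele1985, p. 155] -/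
theorem not_mertens_conjecture_of_kernelTheorem (h₁ : OdlyzkoTeRiele1985_kernelTheorem)
    (h₃ : OdlyzkoTeRiele1985_numerics) : not_mertens_conjecture :=
  not_mertens_conjecture_of_facts h₁ jurkatPeyerimhoffKernel_admissible_holds h₃

/-! ## (B) Brent 1979: the zero clause below `32 585 736.4` -/

/-- **Brent 1979** (Math. Comp. 33, Abstract; §4): "the Riemann zeta function has exactly
75 000 000 zeros of the form `σ + it` in the region `0 < t < 32 585 736.4`; all these zeros are
simple and lie on the line `σ = 1/2`" (`H(75 000 001)` in Brent's notation, established by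
Gram-block sign counting and Turing's method). We record the qualitative part: every zero `ρ` of
`ζ` with `0 < Im ρ < 32 585 736.4` has `Re ρ = 1/2` and `ζ'(ρ) ≠ 0`. A certified machine
computation; it implies the zero clause of `OdlyzkoTeRiele1985_kernelTheorem` /
`OdlyzkoTeRiele1985_numerics` for every `T ≤ 32 585 736.4`, in particular at the paper's
`T = γ₂₀₀₀ ≈ 2515.286` (the paper itself cites the verification of RH for the first `1.5 × 10⁹`
zeros, ref. [26], p. 139). Users take `(h : Brent1979_zerosSimpleOnLine)`.
[cite: Brent1979, Abstract and §4] -/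
def Brent1979_zerosSimpleOnLine : Prop :=
  ∀ ρ : ℂ, riemannZeta ρ = 0 → 0 < ρ.im → ρ.im < 32585736.4 →
    ρ.re = 1 / 2 ∧ deriv riemannZeta ρ ≠ 0

/-- (B) feeds the zero clause of the kernel theorem for every `T ≤ 32 585 736.4`: a zero with
`0 < β < 1`, `|γ| < T` has `γ ≠ 0` (`ζ(σ) < 0` on `(0,1)`, Titchmarsh §2.12:
`riemannZeta_ne_zero_of_im_eq_zero_of_pos_of_lt_one`, `ZetaRealAxis.lean`), and for `γ < 0` one
passes to `ρ̄` (`riemannZeta_conj`, `deriv_riemannZeta_conj` of `LevinsonMontgomery.lean`).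
[cite: Titchmarsh1986, §2.12] -/
theorem zetaZeros_simple_onLine_of_Brent1979 (hB : Brent1979_zerosSimpleOnLine) {T : ℝ}
    (hT : T ≤ 32585736.4) :
    ∀ ρ : ℂ, riemannZeta ρ = 0 → 0 < ρ.re → ρ.re < 1 → |ρ.im| < T →
      ρ.re = 1 / 2 ∧ deriv riemannZeta ρ ≠ 0 := by
  intro ρ hζ h0 h1 hγ
  have hγ' := abs_lt.1 hγ
  rcases lt_trichotomy ρ.im 0 with him | him | him
  · have hζ' : riemannZeta (conj ρ) = 0 := by rw [riemannZeta_conj, hζ, map_zero]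
    have h := hB (conj ρ) hζ' (by simp; linarith) (by simp; linarith)
    refine ⟨by simpa using h.1, fun hd ↦ h.2 ?_⟩
    rw [deriv_riemannZeta_conj, hd, map_zero]
  · exact absurd hζ (riemannZeta_ne_zero_of_im_eq_zero_of_pos_of_lt_one him h0 h1)
  · exact hB ρ hζ him (by linarith)

/-- The numerics of Table 3 with the zero clause supplied by Brent's verification: if `T` is in
Brent's range, the zero clause of `OdlyzkoTeRiele1985_numerics` holds. (A convenience for a
future split of the numerical fact into "zeros below `T`" and "values of `h_K`".)
[cite: OdlyzkoTeRiele1985, p. 139 (ref. [26]) and p. 150] -/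
theorem numerics_zero_clause_of_Brent1979 (hB : Brent1979_zerosSimpleOnLine) {T : ℝ}
    (hT : T ≤ 32585736.4) (ρ : ℂ) (hζ : riemannZeta ρ = 0) (h0 : 0 < ρ.re) (h1 : ρ.re < 1)
    (hγ : |ρ.im| < T) : ρ.re = 1 / 2 ∧ deriv riemannZeta ρ ≠ 0 :=
  zetaZeros_simple_onLine_of_Brent1979 hB hT ρ hζ h0 h1 hγ

/-! ## The kernel theorem (A): discharge of `OdlyzkoTeRiele1985_kernelTheorem` -/

section KernelTheorem

/-! ### A continuous-modification lemma (removable singularities, pointwise form) -/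

/-- If at every point of `S` the function `g` agrees, on a punctured neighbourhood on which it is
continuous, with a function continuous at that point, then `g` has a modification `R` continuous
on `S` and equal to `g` wherever `g` is continuous (`R(z) = lim_{w → z, w ≠ z} g(w)`). [folklore] -/
theorem exists_continuousOn_modification {g : ℂ → ℂ} {S : Set ℂ}
    (h : ∀ s ∈ S, ∃ ψ : ℂ → ℂ, ContinuousAt ψ s ∧ ∀ᶠ z in 𝓝[≠] s, g z = ψ z ∧ ContinuousAt g z) :
    ∃ R : ℂ → ℂ, ContinuousOn R S ∧ ∀ z, ContinuousAt g z → R z = g z := by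
  set R : ℂ → ℂ := fun z ↦ limUnder (𝓝[≠] z) g with hR
  have hRg : ∀ z, ContinuousAt g z → R z = g z := fun z hz ↦
    (hz.tendsto.mono_left nhdsWithin_le_nhds).limUnder_eq
  refine ⟨R, fun s hs ↦ ?_, hRg⟩
  obtain ⟨ψ, hψ, hev⟩ := h s hs
  have h1 : ∀ᶠ z in 𝓝[≠] s, R z = ψ z :=
    hev.mono fun z hz ↦ by rw [hRg z hz.2, hz.1]
  have h2 : R s = ψ s := by
    have : Tendsto g (𝓝[≠] s) (𝓝 (ψ s)) :=
      (hψ.tendsto.mono_left nhdsWithin_le_nhds).congr' (hev.mono fun z hz ↦ hz.1.symm)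
    exact this.limUnder_eq
  have h3 : R =ᶠ[𝓝 s] ψ := by
    rw [eventually_nhdsWithin_iff] at h1
    filter_upwards [h1] with z hz
    by_cases hzs : z = s
    · rw [hzs, h2]
    · exact hz hzs
  exact (hψ.congr_of_eventuallyEq h3).continuousWithinAt

/-! ### The regular part of `Z(s) = 1/((½+s)ζ(½+s))` near the segment `Re s = 0`, `|Im s| ≤ T' < T` -/

variable {T : ℝ}

/-- Membership in the index set of `h_K`. [cite: OdlyzkoTeRiele1985, Theorem p. 144] -/
theorem mem_zetaZerosBelow_toFinset {ρ : ℂ} :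
    ρ ∈ (zetaZerosBelow_finite T).toFinset ↔
      riemannZeta ρ = 0 ∧ 0 < ρ.re ∧ ρ.re < 1 ∧ |ρ.im| < T := by
  rw [Set.Finite.mem_toFinset]; rfl

/-- Under the zero hypothesis of the kernel theorem, every `ρ` in the index set is `½ + iγ` with
`ζ(ρ) = 0 ≠ ζ'(ρ)`. [cite: OdlyzkoTeRiele1985, Theorem p. 144] -/
theorem zetaZerosBelow_spec
    (hz : ∀ ρ : ℂ, riemannZeta ρ = 0 → 0 < ρ.re → ρ.re < 1 → |ρ.im| < T →
      ρ.re = 1 / 2 ∧ deriv riemannZeta ρ ≠ 0)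
    {ρ : ℂ} (hρ : ρ ∈ (zetaZerosBelow_finite T).toFinset) :
    riemannZeta ρ = 0 ∧ deriv riemannZeta ρ ≠ 0 ∧ ρ = 1 / 2 + ρ.im * I ∧ |ρ.im| < T := by
  rw [mem_zetaZerosBelow_toFinset] at hρ
  obtain ⟨h0, h1, h2, h3⟩ := hρ
  obtain ⟨hre, hd⟩ := hz ρ h0 h1 h2 h3
  exact ⟨h0, hd, Complex.ext (by simp [hre]) (by simp), h3⟩

/-- "Good" points: not a pole, `ζ(½+z) ≠ 0`, `½ + z ∉ {0, 1}`. At a good point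
`Z - Σ a_ρ/(z - iγ)` is continuous. [folklore] -/
theorem continuousAt_laplace_sub_polar {z : ℂ}
    (hp : ∀ ρ ∈ (zetaZerosBelow_finite T).toFinset, z ≠ ρ.im * I)
    (hζ : riemannZeta (1 / 2 + z) ≠ 0) (h1 : 1 / 2 + z ≠ 1) (h0 : 1 / 2 + z ≠ 0) :
    ContinuousAt (fun w : ℂ ↦ 1 / ((1 / 2 + w) * riemannZeta (1 / 2 + w)) -
      ∑ ρ ∈ (zetaZerosBelow_finite T).toFinset, 1 / (ρ * deriv riemannZeta ρ) / (w - ρ.im * I)) z := by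
  refine ContinuousAt.sub ?_ ?_
  · have heq : (fun w : ℂ ↦ 1 / ((1 / 2 + w) * riemannZeta (1 / 2 + w))) =
        fun w ↦ ((1 / 2 + w) * riemannZeta (1 / 2 + w))⁻¹ := by
      ext w; exact one_div _
    rw [heq]
    have hc : ContinuousAt (fun w : ℂ ↦ 1 / 2 + w) z :=
      (continuous_const.add continuous_id).continuousAt
    have hζc : ContinuousAt (fun w : ℂ ↦ riemannZeta (1 / 2 + w)) z :=
      (differentiableAt_riemannZeta h1).continuousAt.comp hc
    have hm : ContinuousAt (fun w : ℂ ↦ (1 / 2 + w) * riemannZeta (1 / 2 + w)) z := hc.mul hζc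
    exact hm.inv₀ (mul_ne_zero h0 hζ)
  · refine tendsto_finsetSum _ fun ρ hρ ↦ ?_
    refine ContinuousAt.div continuousAt_const (continuousAt_id.sub continuousAt_const) ?_
    exact sub_ne_zero.2 (hp ρ hρ)

/-- The open box `-¼ < Re z < ½`, `|Im z| < T`: on it the only singularities of `Z` are the
poles `iγ`, by the zero hypothesis (a zero `½ + z` of `ζ` with `0 < Re < 1`, `|Im| < T` is on
the line and simple, hence a pole). [cite: OdlyzkoTeRiele1985, Theorem p. 144] -/
theorem good_of_mem_box
    (hz : ∀ ρ : ℂ, riemannZeta ρ = 0 → 0 < ρ.re → ρ.re < 1 → |ρ.im| < T →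
      ρ.re = 1 / 2 ∧ deriv riemannZeta ρ ≠ 0)
    {z : ℂ} (h1 : -(1 / 4 : ℝ) < z.re) (h2 : z.re < 1 / 2) (h3 : |z.im| < T)
    (hp : ∀ ρ ∈ (zetaZerosBelow_finite T).toFinset, z ≠ ρ.im * I) :
    riemannZeta (1 / 2 + z) ≠ 0 ∧ (1 / 2 + z ≠ 1) ∧ (1 / 2 + z ≠ 0) := by
  refine ⟨fun h0 ↦ ?_, fun h ↦ ?_, fun h ↦ ?_⟩
  · have hre : (1 / 2 + z).re = 1 / 2 + z.re := by simp
    obtain ⟨hre', hd⟩ := hz (1 / 2 + z) h0 (by rw [hre]; linarith) (by rw [hre]; linarith)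
      (by simpa using h3)
    have hmem : (1 / 2 + z) ∈ (zetaZerosBelow_finite T).toFinset := by
      rw [mem_zetaZerosBelow_toFinset]
      exact ⟨h0, by rw [hre]; linarith, by rw [hre]; linarith, by simpa using h3⟩
    refine hp _ hmem (Complex.ext ?_ ?_)
    · simp at hre' ⊢; linarith
    · simp
  · have := congrArg Complex.re h; simp at this; linarith
  · have := congrArg Complex.re h; simp at this; linarith

/-- Near any point of the closed box `0 ≤ Re s ≤ ¼`, `|Im s| ≤ T'` (`T' < T`), all points of a
punctured neighbourhood are good. [folklore] -/
theorem eventually_good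
    (hz : ∀ ρ : ℂ, riemannZeta ρ = 0 → 0 < ρ.re → ρ.re < 1 → |ρ.im| < T →
      ρ.re = 1 / 2 ∧ deriv riemannZeta ρ ≠ 0)
    {T' : ℝ} (hT'T : T' < T) {s : ℂ} (hs : s ∈ Set.Icc (0 : ℝ) (1 / 4) ×ℂ Set.Icc (-T') T') :
    ∀ᶠ z in 𝓝[≠] s, (∀ ρ ∈ (zetaZerosBelow_finite T).toFinset, z ≠ ρ.im * I) ∧
      riemannZeta (1 / 2 + z) ≠ 0 ∧ (1 / 2 + z ≠ 1) ∧ (1 / 2 + z ≠ 0) := by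
  rw [Complex.mem_reProdIm] at hs
  obtain ⟨⟨hs1, hs2⟩, hs3, hs4⟩ := hs
  -- the open box is a neighbourhood of `s`
  have hbox : ∀ᶠ z in 𝓝 s, -(1 / 4 : ℝ) < z.re ∧ z.re < 1 / 2 ∧ |z.im| < T := by
    have ho : IsOpen {z : ℂ | -(1 / 4 : ℝ) < z.re ∧ z.re < 1 / 2 ∧ |z.im| < T} := by
      refine (isOpen_lt continuous_const Complex.continuous_re).inter
        ((isOpen_lt Complex.continuous_re continuous_const).inter
        (isOpen_lt (continuous_abs.comp Complex.continuous_im) continuous_const))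
    refine ho.mem_nhds ⟨?_, ?_, ?_⟩
    · exact lt_of_lt_of_le (by norm_num) hs1
    · exact lt_of_le_of_lt hs2 (by norm_num)
    · exact lt_of_le_of_lt (abs_le.2 ⟨hs3, hs4⟩) hT'T
  -- the poles other than `s` stay away
  have hpoles : ∀ᶠ z in 𝓝[≠] s, ∀ ρ ∈ (zetaZerosBelow_finite T).toFinset, z ≠ ρ.im * I := by
    have hfin : (((zetaZerosBelow_finite T).toFinset.image fun ρ : ℂ ↦ (ρ.im : ℂ) * I : Finset ℂ)
        : Set ℂ).Finite := Finset.finite_toSet _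
    have hcl : IsClosed ((((zetaZerosBelow_finite T).toFinset.image fun ρ : ℂ ↦ (ρ.im : ℂ) * I
        : Finset ℂ) : Set ℂ) \ {s}) := (hfin.subset Set.sdiff_subset).isClosed
    have hmem : s ∈ (((((zetaZerosBelow_finite T).toFinset.image fun ρ : ℂ ↦ (ρ.im : ℂ) * I
        : Finset ℂ) : Set ℂ) \ {s})ᶜ) := by simp
    have h1 := hcl.isOpen_compl.mem_nhds hmem
    rw [eventually_nhdsWithin_iff]
    filter_upwards [h1] with z hz hzs ρ hρ heq
    apply hz
    refine ⟨?_, hzs⟩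
    simp only [Finset.coe_image, Set.mem_image, Finset.mem_coe]
    exact ⟨ρ, hρ, heq.symm⟩
  filter_upwards [hpoles, mem_nhdsWithin_of_mem_nhds hbox] with z hzp hzb
  exact ⟨hzp, good_of_mem_box hz hzb.1 hzb.2.1 hzb.2.2 hzp⟩

/-- **Local structure at a simple zero**: if `ρ₀ = ½ + iγ₀` is a simple zero of `ζ`, then near
`s₀ = iγ₀`, `ζ(½+z) = (z - s₀)·dζ(½+z)` with `dζ = dslope ζ ρ₀` analytic and `dζ(ρ₀) = ζ'(ρ₀) ≠ 0`,
so `1/((½+z)ζ(½+z)) - a₀/(z - s₀) = dslope φ s₀ z` with `φ(z) = 1/((½+z) dζ(½+z))`,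
`a₀ = φ(s₀) = 1/(ρ₀ζ'(ρ₀))`: the singularity is removable (residue bookkeeping of Bateman–Diamond
Thm. 11.12, "`G*` cancels the poles of `G`"). [cite: BatemanDiamond2004, Theorem 11.12 and Remarks 11.13] -/
theorem laplace_sub_polar_eq_dslope {ρ₀ : ℂ} (hζ0 : riemannZeta ρ₀ = 0) {z : ℂ}
    (hz : z ≠ ρ₀ - 1 / 2) :
    1 / ((1 / 2 + z) * riemannZeta (1 / 2 + z)) - 1 / (ρ₀ * deriv riemannZeta ρ₀) / (z - (ρ₀ - 1 / 2)) =
      dslope (fun w : ℂ ↦ 1 / ((1 / 2 + w) * dslope riemannZeta ρ₀ (1 / 2 + w))) (ρ₀ - 1 / 2) z := by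
  have hfac : riemannZeta (1 / 2 + z) = (z - (ρ₀ - 1 / 2)) * dslope riemannZeta ρ₀ (1 / 2 + z) := by
    have h := sub_smul_dslope riemannZeta ρ₀ (1 / 2 + z)
    rw [hζ0, sub_zero, smul_eq_mul] at h
    rw [← h]; congr 1; ring
  rw [dslope_of_ne _ hz, slope_def_field]
  have hρ : (1 / 2 : ℂ) + (ρ₀ - 1 / 2) = ρ₀ := by ring
  rw [hρ, dslope_same, hfac]
  have hne : z - (ρ₀ - 1 / 2) ≠ 0 := sub_ne_zero.2 hz
  field_simp

/-- **The regular part** (existence of `R` in the hypothesis `SmoothingData.laplace_eq` for `m`):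
if the zeros of `ζ` with `0 < β < 1`, `|γ| < T` are simple and on the line, and `0 < T' < T`, there
is a function `R` continuous on the closed rectangle `[0, ¼] × [-T', T']` with
`1/((½+s)ζ(½+s)) = Σ_{|γ|<T} (ρζ'(ρ))⁻¹/(s - iγ) + R(s)` for `0 < Re s ≤ ¼`, `|Im s| ≤ T'`
(Bateman–Diamond Thm. 11.12: "`G - G*` has a continuation as a continuous function on the closed
strip"). [cite: BatemanDiamond2004, Theorem 11.12 (hypothesis on `G - G*`) and §11.7] -/
theorem exists_regularPart
    (hz : ∀ ρ : ℂ, riemannZeta ρ = 0 → 0 < ρ.re → ρ.re < 1 → |ρ.im| < T →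
      ρ.re = 1 / 2 ∧ deriv riemannZeta ρ ≠ 0)
    {T' : ℝ} (hT'T : T' < T) :
    ∃ R : ℂ → ℂ, ContinuousOn R (Set.Icc (0 : ℝ) (1 / 4) ×ℂ Set.Icc (-T') T') ∧
      ∀ σ t : ℝ, 0 < σ → σ ≤ 1 / 4 → |t| ≤ T' →
        1 / ((1 / 2 + ((σ : ℂ) + t * I)) * riemannZeta (1 / 2 + ((σ : ℂ) + t * I))) =
          ∑ ρ ∈ (zetaZerosBelow_finite T).toFinset,
            1 / (ρ * deriv riemannZeta ρ) / ((σ : ℂ) + t * I - ρ.im * I) + R (σ + t * I) := by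
  set P := (zetaZerosBelow_finite T).toFinset with hP
  set g : ℂ → ℂ := fun w ↦ 1 / ((1 / 2 + w) * riemannZeta (1 / 2 + w)) -
    ∑ ρ ∈ P, 1 / (ρ * deriv riemannZeta ρ) / (w - ρ.im * I) with hg
  have hmod : ∀ s ∈ Set.Icc (0 : ℝ) (1 / 4) ×ℂ Set.Icc (-T') T',
      ∃ ψ : ℂ → ℂ, ContinuousAt ψ s ∧ ∀ᶠ z in 𝓝[≠] s, g z = ψ z ∧ ContinuousAt g z := by
    intro s hs
    have hev := eventually_good hz hT'T hs
    by_cases hpole : ∃ ρ₀ ∈ P, s = ρ₀.im * I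
    · obtain ⟨ρ₀, hρ₀, rfl⟩ := hpole
      obtain ⟨hζ0, hd0, hρeq, -⟩ := zetaZerosBelow_spec hz hρ₀
      have hρ1 : ρ₀ ≠ 1 := by
        intro h; rw [h] at hζ0; exact riemannZeta_one_ne_zero hζ0
      have hs0 : (ρ₀.im : ℂ) * I = ρ₀ - 1 / 2 := by
        conv_rhs => rw [hρeq]
        ring
      set φ : ℂ → ℂ := fun w ↦ 1 / ((1 / 2 + w) * dslope riemannZeta ρ₀ (1 / 2 + w)) with hφ
      set ψ : ℂ → ℂ := fun w ↦ dslope φ (ρ₀ - 1 / 2) w -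
        ∑ ρ ∈ P.erase ρ₀, 1 / (ρ * deriv riemannZeta ρ) / (w - ρ.im * I) with hψ
      refine ⟨ψ, ?_, ?_⟩
      · -- continuity of `ψ` at the pole
        refine ContinuousAt.sub ?_ ?_
        · rw [hs0]
          refine continuousAt_dslope_same.2 ?_
          -- `φ` is differentiable at `ρ₀ - 1/2`
          have hζd : DifferentiableOn ℂ riemannZeta {(1 : ℂ)}ᶜ := fun w hw ↦
            (differentiableAt_riemannZeta hw).differentiableWithinAt
          have hζa : AnalyticAt ℂ riemannZeta ρ₀ :=
            hζd.analyticAt (isOpen_compl_singleton.mem_nhds hρ1)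
          have hda : AnalyticAt ℂ (dslope riemannZeta ρ₀) ρ₀ := by
            obtain ⟨p, hp⟩ := hζa
            exact ⟨_, hp.has_fpower_series_dslope_fslope⟩
          have hρ : (1 / 2 : ℂ) + (ρ₀ - 1 / 2) = ρ₀ := by ring
          have hd1 : DifferentiableAt ℂ (dslope riemannZeta ρ₀) (1 / 2 + (ρ₀ - 1 / 2)) := by
            rw [hρ]; exact hda.differentiableAt
          have hinner : DifferentiableAt ℂ (fun w : ℂ ↦ 1 / 2 + w) (ρ₀ - 1 / 2) :=
            (differentiableAt_const _).add differentiableAt_id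
          have hd2 : DifferentiableAt ℂ (fun w : ℂ ↦ dslope riemannZeta ρ₀ (1 / 2 + w)) (ρ₀ - 1 / 2) :=
            hd1.comp (ρ₀ - 1 / 2) hinner
          have hA : DifferentiableAt ℂ (fun w : ℂ ↦ (1 / 2 + w) * dslope riemannZeta ρ₀ (1 / 2 + w))
              (ρ₀ - 1 / 2) := hinner.mul hd2
          have hρ0 : ρ₀ ≠ 0 := by
            intro h; have := congrArg Complex.re h; rw [hρeq] at this; simp at this
          have hA0 : (1 / 2 + (ρ₀ - 1 / 2)) * dslope riemannZeta ρ₀ (1 / 2 + (ρ₀ - 1 / 2)) ≠ 0 := by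
            rw [hρ, dslope_same]; exact mul_ne_zero hρ0 hd0
          exact (differentiableAt_const (1 : ℂ)).div hA hA0
        · refine tendsto_finsetSum _ fun ρ hρ ↦ ?_
          refine ContinuousAt.div continuousAt_const (continuousAt_id.sub continuousAt_const) ?_
          rw [Finset.mem_erase] at hρ
          intro heq
          apply hρ.1
          have h2 := (zetaZerosBelow_spec hz hρ.2).2.2.1
          have him : ρ₀.im = ρ.im := by
            have := congrArg Complex.im (sub_eq_zero.1 heq)
            simpa using this
          rw [h2, hρeq, him]
      · filter_upwards [hev, self_mem_nhdsWithin] with z hgood hzs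
        refine ⟨?_, continuousAt_laplace_sub_polar hgood.1 hgood.2.1 hgood.2.2.1 hgood.2.2.2⟩
        simp only [hg, hψ]
        rw [← Finset.add_sum_erase P _ hρ₀, hs0,
          ← laplace_sub_polar_eq_dslope hζ0 (by rwa [← hs0])]
        ring
    · refine ⟨g, ?_, ?_⟩
      · have hgood : (∀ ρ ∈ P, s ≠ ρ.im * I) := fun ρ hρ h ↦ hpole ⟨ρ, hρ, h⟩
        rw [Complex.mem_reProdIm] at hs
        obtain ⟨⟨hs1, hs2⟩, hs3, hs4⟩ := hs
        have hb := good_of_mem_box hz (z := s) (by linarith) (by linarith)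
          (lt_of_le_of_lt (abs_le.2 ⟨hs3, hs4⟩) hT'T) hgood
        exact continuousAt_laplace_sub_polar hgood hb.1 hb.2.1 hb.2.2
      · filter_upwards [hev] with z hgood
        exact ⟨rfl, continuousAt_laplace_sub_polar hgood.1 hgood.2.1 hgood.2.2.1 hgood.2.2.2⟩
  obtain ⟨R, hRc, hRg⟩ := exists_continuousOn_modification hmod
  refine ⟨R, hRc, fun σ t hσ hσ' ht ↦ ?_⟩
  have hgood : ∀ ρ ∈ P, (σ : ℂ) + t * I ≠ ρ.im * I := by
    intro ρ _ h
    have := congrArg Complex.re h; simp at this; linarith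
  have hb := good_of_mem_box hz (z := (σ : ℂ) + t * I) (by simp; linarith) (by simp; linarith)
    (by simpa using lt_of_le_of_lt ht hT'T) hgood
  have hcont := continuousAt_laplace_sub_polar hgood hb.1 hb.2.1 hb.2.2
  rw [hRg _ hcont]
  simp only [hg]
  ring

/-! ### The kernel: integrability, mass one, dilation -/

/-- An even continuous kernel with `K(y) = O((1+y²)⁻¹)` at `+∞` is integrable. [folklore] -/
theorem integrable_of_even_isBigO {K : ℝ → ℝ} (hKc : Continuous K) (hev : ∀ y, K (-y) = K y)
    (hO : K =O[atTop] fun y : ℝ ↦ (1 + y ^ 2)⁻¹) : Integrable K := by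
  obtain ⟨c, hc⟩ := hO.bound
  obtain ⟨y₁, hy₁⟩ := eventually_atTop.1 hc
  -- a bound on the compact interval `[-|y₁|, |y₁|]`
  obtain ⟨B, hB⟩ := (isCompact_Icc (a := -|y₁|) (b := |y₁|)).exists_bound_of_continuousOn
    (f := fun y : ℝ ↦ K y * (1 + y ^ 2)) (by fun_prop)
  set C : ℝ := max c B with hC
  refine Integrable.mono' (integrable_inv_one_add_sq.const_mul C) hKc.aestronglyMeasurable
    (ae_of_all _ fun y ↦ ?_)
  have hpos : 0 < 1 + y ^ 2 := by positivity
  rw [Real.norm_eq_abs]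
  by_cases hy : |y| ≤ |y₁|
  · have h : |K y| * (1 + y ^ 2) ≤ B := by
      have := hB y (abs_le.1 hy)
      rw [Real.norm_eq_abs, abs_mul, abs_of_pos hpos] at this
      exact this
    rw [← div_eq_mul_inv, le_div_iff₀ hpos]
    exact h.trans (le_max_right _ _)
  · push Not at hy
    have hy' : y₁ ≤ |y| := (le_abs_self y₁).trans hy.le
    have key : |K (|y|)| ≤ c * (1 + y ^ 2)⁻¹ := by
      have := hy₁ (|y|) hy'
      rwa [Real.norm_eq_abs, Real.norm_eq_abs, sq_abs, abs_of_pos (inv_pos.2 hpos)] at this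
    have hKy : K y = K (|y|) := by
      rcases abs_choice y with h | h
      · rw [h]
      · rw [h, hev]
    rw [hKy]
    exact key.trans (mul_le_mul_of_nonneg_right (le_max_left _ _) (inv_pos.2 hpos).le)

/-- `∫ K = 1` from `k(0) = 1`. [cite: OdlyzkoTeRiele1985, Theorem p. 144 (hypothesis `k(0) = 1`)] -/
theorem integral_eq_one_of_kernelTransform_zero {K : ℝ → ℝ} (h0 : kernelTransform K 0 = 1) :
    ∫ y, K y = 1 := by
  unfold kernelTransform at h0
  simp only [Complex.ofReal_zero, zero_mul, mul_zero, neg_zero, Complex.exp_zero, mul_one] at h0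
  rw [integral_complex_ofReal] at h0
  exact_mod_cast h0

/-- Dilation of the kernel: `K_c(y) = K(y/c)/c` has transform `k_c(t) = k(ct)` (`c > 0`).
[cite: OdlyzkoTeRiele1985, §2 (2.9)] -/
theorem kernelTransform_dilate {K : ℝ → ℝ} {c : ℝ} (hc : 0 < c) (t : ℝ) :
    kernelTransform (fun y ↦ K (y / c) / c) t = kernelTransform K (c * t) := by
  unfold kernelTransform
  have hc' : (c : ℂ) ≠ 0 := by exact_mod_cast hc.ne'
  set G : ℝ → ℂ := fun v ↦ ((K v : ℝ) : ℂ) * cexp (-(I * (((c * t : ℝ) : ℂ) * (v : ℂ)))) with hG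
  have heq : ∀ y : ℝ, (((K (y / c) / c : ℝ)) : ℂ) * cexp (-(I * ((t : ℂ) * (y : ℂ)))) =
      ((c⁻¹ : ℝ) : ℂ) * G (y / c) := by
    intro y
    have harg : -(I * ((t : ℂ) * (y : ℂ))) = -(I * (((c * t : ℝ) : ℂ) * ((y / c : ℝ) : ℂ))) := by
      push_cast; field_simp
    rw [harg]
    simp only [hG]
    push_cast
    ring
  simp_rw [heq]
  rw [integral_const_mul, Measure.integral_comp_div G c, abs_of_pos hc, Complex.real_smul,
    ← mul_assoc]
  push_cast
  rw [inv_mul_cancel₀ hc', one_mul]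

/-- The dilated kernel has mass `∫ K_c = ∫ K`. [folklore] -/
theorem integral_dilate {K : ℝ → ℝ} {c : ℝ} (hc : 0 < c) :
    ∫ y, K (y / c) / c = ∫ y, K y := by
  have h := Measure.integral_comp_div (fun v ↦ K v / c) c
  rw [h, abs_of_pos hc, smul_eq_mul, integral_div, mul_div_cancel₀ _ hc.ne']

/-- The dilated kernel is integrable. [folklore] -/
theorem integrable_dilate {K : ℝ → ℝ} (hK : Integrable K) {c : ℝ} (hc : 0 < c) :
    Integrable (fun y ↦ K (y / c) / c) :=
  (hK.comp_div hc.ne').div_const c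

/-! ### The theorem -/

/-- **Discharge of the named fact `OdlyzkoTeRiele1985_kernelTheorem`** — the kernel theorem of
Ingham (1942) / Jurkat–Peyerimhoff (1976) as printed by Odlyzko–te Riele (§2, Theorem p. 144):
for an admissible kernel `K` (`C²`, `≥ 0`, even, `O((1+y²)⁻¹)`, transform `k` vanishing for
`|t| ≥ T`, `k(0) = 1`), if the zeros `β + iγ` of `ζ` with `0 < β < 1`, `|γ| < T` are simple and on
the line, then for every `y₀`: `M(x) > a√x` for arbitrarily large `x` whenever `a < Re h_K(y₀)`,
and dually.

Proof (assembling the three preceding files): by Landau's theorem a one-sided bound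
on `m(u) = M(e^u)e^{-u/2}` makes `m(u)e^{-σu}` integrable and identifies its Laplace transform with
`1/((½+s)ζ(½+s))` (`MertensOneSided.lean`); the zero hypothesis makes the polar part
`Σ (ρζ'(ρ))⁻¹/(s-iγ)` exact up to a function continuous on `[0,¼] × [-T',T']` for every
`T' < T` (`exists_regularPart`); the abstract oscillation theorem
`InghamSmoothing.frequently_gt_and_lt_of_laplace` (B–D Thm. 11.12 for band-limited kernels) is
applied to the *dilated* kernel `K_c(y) = K(y/c)/c`, `c > 1`, whose transform `k(ct)` is
supported in `[-T/c, T/c] ⊂ (-T, T)` — this keeps zeros of ordinate exactly `±T` (not covered by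
the hypothesis) off the closed rectangle — and `c → 1⁺` recovers `h_K(y₀)` by continuity of `k`.
[cite: OdlyzkoTeRiele1985, §2 Theorem p. 144, (2.17)–(2.18); BatemanDiamond2004, Theorem 11.12; Ingham1942] -/
theorem OdlyzkoTeRiele1985_kernelTheorem_holds : OdlyzkoTeRiele1985_kernelTheorem := by
  intro K T hK2 hKnn hKev hKO hkz hk0 hzeros y₀
  -- `T > 0`
  have hT : 0 < T := by
    by_contra h
    push Not at h
    have := hkz 0 (by simpa using h)
    rw [this] at hk0
    exact zero_ne_one hk0
  have hKc : Continuous K := hK2.continuous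
  have hKi : Integrable K := integrable_of_even_isBigO hKc hKev hKO
  have hk : ∀ t, kernelTransform K t = ∫ y, (K y : ℂ) * cexp (-((t * y : ℝ) : ℂ) * I) :=
    kernelTransform_eq_integral K
  have hK1 : ∫ y, K y = 1 := integral_eq_one_of_kernelTransform_zero hk0
  have hkc : Continuous (kernelTransform K) := InghamSmoothing.continuous_transform hKi hk
  -- notation
  set P := (zetaZerosBelow_finite T).toFinset with hP
  set a : ℂ → ℂ := fun ρ ↦ 1 / (ρ * deriv riemannZeta ρ) with ha
  set S : ℝ → ℂ := fun c ↦ ∑ ρ ∈ P, a ρ * kernelTransform K (c * ρ.im) *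
    cexp (((ρ.im * y₀ : ℝ) : ℂ) * I) with hS
  have hS1 : S 1 = inghamSum (kernelTransform K) T y₀ := by
    simp only [hS, inghamSum, ha, ← hP, one_mul]
    refine Finset.sum_congr rfl fun ρ _ ↦ ?_
    rw [div_eq_mul_one_div, show I * ((ρ.im : ℂ) * (y₀ : ℂ)) = ((ρ.im * y₀ : ℝ) : ℂ) * I by
      push_cast; ring]
    ring
  have hSc : Tendsto S (𝓝[>] 1) (𝓝 (S 1)) := by
    refine Tendsto.mono_left (Continuous.tendsto ?_ 1) nhdsWithin_le_nhds
    refine continuous_finsetSum _ fun ρ _ ↦ ?_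
    exact (continuous_const.mul (hkc.comp (continuous_mul_const _))).mul continuous_const
  -- the abstract theorem for the dilated kernel, `c > 1`
  have key : ∀ c : ℝ, 1 < c → ∀ ε : ℝ, 0 < ε →
      (∃ᶠ y in atTop, (S c).re - ε < normalizedMertens y) ∧
      (∃ᶠ y in atTop, normalizedMertens y < (S c).re + ε) := by
    intro c hc ε hε
    have hc0 : 0 < c := by linarith
    have hT' : T / c < T := by
      rw [div_lt_iff₀ hc0]; nlinarith
    obtain ⟨R, hRc, hRid⟩ := exists_regularPart hzeros hT'
    have hKci : Integrable (fun y ↦ K (y / c) / c) := integrable_dilate hKi hc0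
    have hkc_eq : ∀ t, kernelTransform (fun y ↦ K (y / c) / c) t = kernelTransform K (c * t) :=
      kernelTransform_dilate hc0
    have hks : ∀ t, T / c ≤ |t| → kernelTransform (fun y ↦ K (y / c) / c) t = 0 := by
      intro t ht
      rw [hkc_eq]
      refine hkz _ ?_
      rw [abs_mul, abs_of_pos hc0]
      rwa [div_le_iff₀' hc0] at ht
    have hL : ∀ A : ℝ, ((∀ u, normalizedMertens u ≤ A) ∨ (∀ u, -A ≤ normalizedMertens u)) →
        (∀ σ, 0 < σ → Integrable (fun u ↦ normalizedMertens u * Real.exp (-(σ * u)))) ∧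
        ∃ R : ℂ → ℂ, ContinuousOn R (Set.Icc 0 (1 / 4) ×ℂ Set.Icc (-(T / c)) (T / c)) ∧
          ∀ σ t : ℝ, 0 < σ → σ ≤ 1 / 4 → |t| ≤ T / c →
            ∫ u, (normalizedMertens u : ℂ) * cexp (-(((σ : ℂ) + t * I) * u)) =
              ∑ ρ ∈ P, a ρ / ((σ : ℂ) + t * I - ρ.im * I) + R (σ + t * I) := by
      intro A hA
      obtain ⟨hint, hlap⟩ := normalizedMertens_laplace_of_oneSided hA
      refine ⟨hint, R, hRc, fun σ t hσ hσ' ht ↦ ?_⟩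
      rw [hlap σ t hσ (by linarith),
        show (1 / 2 : ℂ) + σ + t * I = 1 / 2 + ((σ : ℂ) + t * I) by ring, hRid σ t hσ hσ' ht]
    have h := InghamSmoothing.frequently_gt_and_lt_of_laplace P (fun ρ : ℂ ↦ ρ.im) a
      (f := normalizedMertens) (K := fun y ↦ K (y / c) / c)
      (k := fun t ↦ kernelTransform (fun y ↦ K (y / c) / c) t) (σ₀ := 1 / 4) (T' := T / c)
      measurable_normalizedMertens (fun u hu ↦ normalizedMertens_of_neg hu)
      normalizedMertens_locally_bounded
      ((hKc.comp (continuous_id.div_const c)).div_const c)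
      (fun v ↦ div_nonneg (hKnn _) hc0.le) hKci (by rw [integral_dilate hc0, hK1])
      (fun t ↦ kernelTransform_eq_integral _ t) hks (by norm_num) hL y₀ hε
    have hsum : ∑ ρ ∈ P, a ρ * kernelTransform (fun y ↦ K (y / c) / c) ρ.im *
        cexp (((ρ.im * y₀ : ℝ) : ℂ) * I) = S c := by
      simp only [hS]
      exact Finset.sum_congr rfl fun ρ _ ↦ by rw [hkc_eq]
    rw [hsum] at h
    exact h
  -- `c → 1⁺`
  have hclose : ∀ ε : ℝ, 0 < ε → ∃ c : ℝ, 1 < c ∧ |(S c).re - (S 1).re| < ε := by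
    intro ε hε
    have h1 : ∀ᶠ c in 𝓝[>] (1 : ℝ), dist (S c) (S 1) < ε := (Metric.tendsto_nhds.1 hSc) ε hε
    obtain ⟨c, hc, hc1⟩ := (h1.and self_mem_nhdsWithin).exists
    refine ⟨c, hc1, lt_of_le_of_lt ?_ hc⟩
    rw [← Complex.sub_re, dist_eq_norm]
    exact Complex.abs_re_le_norm _
  rw [← hS1]
  constructor
  · intro b hb
    obtain ⟨c, hc1, hc⟩ := hclose (((S 1).re - b) / 2) (by linarith)
    have h := (key c hc1 (((S 1).re - b) / 2) (by linarith)).1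
    refine frequently_mertens_gt_of_normalizedMertens (h.mono fun y hy ↦ ?_)
    have := (abs_lt.1 hc).1
    linarith
  · intro b hb
    obtain ⟨c, hc1, hc⟩ := hclose ((b - (S 1).re) / 2) (by linarith)
    have h := (key c hc1 ((b - (S 1).re) / 2) (by linarith)).2
    refine frequently_mertens_lt_of_normalizedMertens (h.mono fun y hy ↦ ?_)
    have := (abs_lt.1 hc).2
    linarith

/-- **The positive side of the disproof, from the numerics alone**: with (A) and (D) discharged,
`limsup M(x) x^{-1/2} > 1.06` (rh.S22) follows from the certified numerics of §4
(`OdlyzkoTeRiele1985_numerics`: 2000 zeros to 100 digits, Table 3). [cite: OdlyzkoTeRiele1985, §1 p. 139 and §4.3 p. 155] -/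
theorem odlyzko_te_riele_limsup_of_numerics (h : OdlyzkoTeRiele1985_numerics) :
    odlyzko_te_riele_limsup :=
  odlyzko_te_riele_limsup_of_kernelTheorem OdlyzkoTeRiele1985_kernelTheorem_holds h

/-- Likewise `liminf M(x) x^{-1/2} < -1.009`. [cite: OdlyzkoTeRiele1985, §1 p. 139 and §4.3 p. 155] -/
theorem odlyzko_te_riele_liminf_of_numerics (h : OdlyzkoTeRiele1985_numerics) :
    odlyzko_te_riele_liminf :=
  odlyzko_te_riele_liminf_of_kernelTheorem OdlyzkoTeRiele1985_kernelTheorem_holds h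

/-- And the Mertens conjecture is false, from the numerics alone. [cite: OdlyzkoTeRiele1985, p. 155] -/
theorem not_mertens_conjecture_of_numerics (h : OdlyzkoTeRiele1985_numerics) :
    not_mertens_conjecture :=
  not_mertens_conjecture_of_kernelTheorem OdlyzkoTeRiele1985_kernelTheorem_holds h

end KernelTheorem

end Literature.NumberTheory.LFunctions
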